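import Mathlib
import Summits.NavierStokesRegularity.NavierStokesRegularity.Theorems.LevelSetModerationHighSpeedPressureWorkFourThreshold
import Literature.Analysis.FluidPDE.ClassicalOvershootBound
import Literature.Analysis.FluidPDE.LerayHopfProofs

/-!
# Route LevelSetModeration — `HighSpeedPressureWork`: the early bookkeeping holds at every positive margin

Support file for item stmt-NavierStokesRegularity-18149 (`HighSpeedPressureWork`), line
`iso-speed-area-closure` (skeleton v4: `crux ⟸ stub_isoSpeedAreaLaw ∧ stub_earlyBookkeeping`).
The registered stub `stub_earlyBookkeeping` asks, UNCONDITIONALLY, for the pairing bound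
`PW_c(t) ≤ √(F(E₀,B₀) V_c(T)) √(D_c(T))` in the early time window `t ≤ cₑν/B₀²` at all levels
`c ≥ B₀` (windows `M ≥ 2B₀`). This file proves it at every positive margin:

* `levelSetModeration_exists_marginModulus` — per solution: a solution of the class bounded by
  `g` on `[0,T)` obeys the pairing bound on all windows `M ≥ 2(1+θ)B₀`, with an explicit
  nonnegative modulus `Kf(θ, g, E₀, B₀)` (overshoot bound `|u(τ)| ≤ B₀ + C_oG₀²√(τ/ν)`
  `exists_norm_le_initial_add_of_speed_le` ⇒ no fast point above `(1+θ)B₀` before `ν/G'²`,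
  `G' = max(G₀, C_oG₀²/(θB₀))`; pointwise pressure bound after that delay; slice integration by
  parts `levelSetModeration_pairing_le_of_pressureBound`);
* `levelSetModeration_earlyBookkeepingWithMargin` — UNCONDITIONAL: there is an absolute `cₑ > 0`
  (half the early-window constant) such that for all `ν, T > 0`, `θ > 0` there is `F` with the
  pairing bound for `t ≤ cₑν/B₀²` on all windows `M ≥ 2(1+θ)B₀`: on the horizon
  `Tₑ = min(T, c₀ν/B₀²)` every member of the class is bounded by `2B₀`
  (`levelSetModeration_earlyWindow`), so the per-solution bound applies on `[0,Tₑ)`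
  (`IsLerayHopfOn.of_le`), and `V_c(Tₑ) ≤ V_c(T)`, `D_c(Tₑ) ≤ D_c(T)`.

Hence the whole content of `stub_earlyBookkeeping` — and, by
`levelSetModeration_highSpeedPressureWorkMargin_iff_uniformBound`, the whole content of the crux
beyond class-uniform boundedness — is the limit of vanishing margin, levels `c ↓ B₀ = sup|u₀|`, in
the early window.
-/

noncomputable section

-- single-conjunct summit: `Summit.<Summit>.<Problem>` repeats the name by the D-0017 layout
set_option linter.dupNamespace false

namespace Summit.NavierStokesRegularity.NavierStokesRegularity.Theorems

open MeasureTheory Set Filter Topology Function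
open scoped ENNReal
open Literature.Analysis.FluidPDE

/-! ### The margin modulus for one bounded solution -/

/-- **Pairing bound with margin for ONE bounded solution** (the mechanism of
`levelSetModeration_bookkeepingWithMargin`, per solution and per horizon, explicit modulus):
for `ν > 0` there is a nonnegative modulus `Kf(θ, g, E₀, B₀)` such that every classical
Leray–Hopf solution on `ℝ³ × [0,T)` from a rapidly decaying datum with `∫|u₀|² ≤ E₀`, `|u₀| ≤ B₀`,
bounded by `g` on `[0,T) × ℝ³`, satisfies for every `θ > 0` the pairing bound
`PW_c(t) ≤ √(Kf² V_c(T)) √(D_c(T))` on all windows `M ≥ 2(1+θ)B₀`, `c ∈ [M/2,M]`, `c > 0`,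
`t ∈ [0,T)` (overshoot bound: fast points above `(1+θ)B₀` occur only after `ν/G'²`; pressure sup
bound after that delay; `levelSetModeration_pairing_le_of_pressureBound`). [folklore] -/
theorem levelSetModeration_exists_marginModulus {ν : ℝ} (hν : 0 < ν) :
    ∃ Kf : ℝ → ℝ → ℝ → ℝ → ℝ, (∀ θ g E₀ B₀, 0 ≤ Kf θ g E₀ B₀) ∧
      ∀ {T : ℝ}, 0 < T → ∀ {u : ℝ → EuclideanSpace ℝ (Fin 3) → EuclideanSpace ℝ (Fin 3)}
        {p : ℝ → EuclideanSpace ℝ (Fin 3) → ℝ}, IsClassicalNSSolutionOn (Ico 0 T) ν 0 u p →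
        IsLerayHopfOn T ν 0 (u 0) u → HasRapidSpatialDecay (u 0) →
        ∀ {E₀ B₀ : ℝ}, (∫ x, ‖u 0 x‖ ^ 2) ≤ E₀ → (∀ x, ‖u 0 x‖ ≤ B₀) →
        ∀ {g : ℝ}, (∀ s ∈ Ico 0 T, ∀ x, ‖u s x‖ ≤ g) → ∀ {θ : ℝ}, 0 < θ →
        ∀ (M c t : ℝ), 2 * (1 + θ) * B₀ ≤ M → M / 2 ≤ c → c ≤ M → 0 < c → t ∈ Ico 0 T →
          -(∫ τ in Ioo 0 t, ∫ x, max (1 - c / ‖u τ x‖) 0 *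
              (fderiv ℝ (normalisedPressure (u τ)) x (u τ x))) ≤
            Real.sqrt ((Kf θ g E₀ B₀) ^ 2 * (∫⁻ τ in Ioo 0 T, volume {x | c < ‖u τ x‖}).toReal) *
              Real.sqrt ((∫⁻ τ in Ioo 0 T, ∫⁻ x, {x | c < ‖u τ x‖}.indicator
                (fun x => ENNReal.ofReal (‖fderiv ℝ (fun y => ‖u τ y‖) x‖ ^ 2)) x).toReal) := by
  obtain ⟨Cₒ, hCₒ, hO⟩ := exists_norm_le_initial_add_of_speed_le
  obtain ⟨C, hC0, hP⟩ := levelSetModeration_exists_pressureSupBound_delay one_pos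
  -- the modulus: `G₀ = max(g,|B₀|)+1`, `G' = max(G₀, Cₒ G₀²/(θ|B₀|)) + 1`,
  -- `Kf θ g E₀ B₀ = G'²/3 + 8G'(C G'²/ν) + E₀⁺/(2π)`
  refine ⟨fun θ g E₀ B₀ =>
    (max (max g |B₀| + 1) (Cₒ * (max g |B₀| + 1) ^ 2 / (θ * |B₀|)) + 1) ^ 2 / 3 +
      8 * (max (max g |B₀| + 1) (Cₒ * (max g |B₀| + 1) ^ 2 / (θ * |B₀|)) + 1) *
        (C * (max (max g |B₀| + 1) (Cₒ * (max g |B₀| + 1) ^ 2 / (θ * |B₀|)) + 1) ^ 2 / ν) +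
      max E₀ 0 / (2 * Real.pi), fun θ g E₀ B₀ => by positivity, ?_⟩
  intro T hT u p hcl hLH hdec E₀ B₀ hE₀ hbd0 g hbg θ hθ M c t hM hMc hcM hc ht
  set G₀ : ℝ := max g |B₀| + 1 with hG₀
  set G' : ℝ := max G₀ (Cₒ * G₀ ^ 2 / (θ * |B₀|)) + 1 with hG'
  set K : ℝ := G' ^ 2 / 3 + 8 * G' * (C * G' ^ 2 / ν) + max E₀ 0 / (2 * Real.pi) with hKdef
  have hG₀pos : 0 < G₀ := by
    rw [hG₀]; exact lt_of_le_of_lt (le_trans (abs_nonneg _) (le_max_right _ _)) (lt_add_one _)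
  have hG'pos : 0 < G' := by
    rw [hG']; exact lt_of_le_of_lt (hG₀pos.le.trans (le_max_left _ _)) (lt_add_one _)
  have hG₀G' : G₀ ≤ G' := by rw [hG']; linarith [le_max_left G₀ (Cₒ * G₀ ^ 2 / (θ * |B₀|))]
  have hK0 : 0 ≤ K := by rw [hKdef]; positivity
  have hbd : ∀ s ∈ Ico 0 T, ∀ x, ‖u s x‖ ≤ G₀ := fun s hs x =>
    (hbg s hs x).trans (by rw [hG₀]; linarith [le_max_left g |B₀|])
  have hbdG' : ∀ s ∈ Ico 0 T, ∀ x, ‖u s x‖ ≤ G' := fun s hs x => (hbd s hs x).trans hG₀G'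
  have hE₀' : (∫ x, ‖u 0 x‖ ^ 2) ≤ max E₀ 0 := hE₀.trans (le_max_left _ _)
  beta_reduce
  show -(∫ τ in Ioo 0 t, ∫ x, max (1 - c / ‖u τ x‖) 0 *
      (fderiv ℝ (normalisedPressure (u τ)) x (u τ x))) ≤
    Real.sqrt (K ^ 2 * (∫⁻ τ in Ioo 0 T, volume {x | c < ‖u τ x‖}).toReal) *
      Real.sqrt ((∫⁻ τ in Ioo 0 T, ∫⁻ x, {x | c < ‖u τ x‖}.indicator
        (fun x => ENNReal.ofReal (‖fderiv ℝ (fun y => ‖u τ y‖) x‖ ^ 2)) x).toReal)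
  refine levelSetModeration_pairing_le_of_pressureBound hν hT hcl hLH hdec hc le_rfl ht hK0 ?_
  intro τ hτ x hx
  have hτ' : τ ∈ Ico 0 T := ⟨hτ.1.le, hτ.2.trans ht.2⟩
  -- the datum is not zero (else `u ≡ 0` and nothing is fast), so `B₀ > 0`
  have hB₀ : 0 < B₀ := by
    by_contra hB
    rw [not_lt] at hB
    have h0 : ∀ y, u 0 y = 0 := fun y => norm_le_zero_iff.1 ((hbd0 y).trans hB)
    have := levelSetModeration_slice_eq_zero_of_datum hcl hLH hν.le h0 hτ' x
    rw [this, norm_zero] at hx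
    exact absurd hx (not_lt.2 hc.le)
  have hBabs : |B₀| = B₀ := abs_of_pos hB₀
  -- uniform `L²` bound of the slices (for the overshoot bound)
  set KK : ℝ≥0∞ := (ENNReal.ofReal (∫ x, ‖u 0 x‖ ^ 2)) ^ (1 / 2 : ℝ) with hKK
  have hKKtop : KK ≠ ⊤ := ENNReal.rpow_ne_top_of_nonneg (by norm_num) ENNReal.ofReal_ne_top
  have hL2 : ∀ s ∈ Icc 0 T, s < T → eLpNorm (u s) 2 volume ≤ KK := by
    intro s hs _
    have h := lintegral_enorm_sq_le_of_lerayHopf hLH hν.le hs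
    rw [eLpNorm_eq_lintegral_rpow_enorm_toReal (by norm_num) (by norm_num), ENNReal.toReal_ofNat, hKK]
    refine ENNReal.rpow_le_rpow ?_ (by norm_num)
    refine le_trans (le_of_eq ?_) h
    exact lintegral_congr fun x => by rw [ENNReal.rpow_two]
  -- the overshoot bound at `τ` on the horizon `T'' = (τ + T)/2`: `(1+θ)B₀ < ‖u τ x‖ ≤ B₀ + Cₒ G₀² √(τ/ν)`
  set T'' : ℝ := (τ + T) / 2 with hT''
  have hT''pos : 0 < T'' := by rw [hT'']; linarith [hτ.1, hτ.2, ht.2]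
  have hT''T : T'' < T := by rw [hT'']; linarith [hτ.2, ht.2]
  have hτT'' : τ < T'' := by rw [hT'']; linarith [hτ.2, ht.2]
  have hbd'' : ∀ s ∈ Icc 0 T'', ∀ y, ‖u s y‖ ≤ G₀ := fun s hs y => hbd s ⟨hs.1, hs.2.trans_lt hT''T⟩ y
  have hover := hO hν hG₀pos hcl hT''pos hT''T hbd'' hKKtop
    (fun s hs => hL2 s ⟨hs.1, hs.2.trans hT''T.le⟩ (hs.2.trans_lt hT''T)) hbd0 τ ⟨hτ.1, hτT''⟩ x
  have hcθ : (1 + θ) * B₀ ≤ c := by linarith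
  have hgap : θ * B₀ < Cₒ * G₀ ^ 2 * Real.sqrt (τ / ν) := by
    have h1 : (1 + θ) * B₀ < B₀ + Cₒ * G₀ ^ 2 * Real.sqrt (τ / ν) := lt_of_le_of_lt hcθ (hx.trans_le hover)
    linarith
  -- hence `τ > ν / G'²`
  have hdelay : 1 * ν / G' ^ 2 < τ := by
    rw [one_mul]
    -- `G' ≥ Cₒ G₀²/(θ B₀)`, so `θ B₀ G' ≥ Cₒ G₀²`, and `θ B₀ < Cₒ G₀² √(τ/ν)` gives `1 < G' √(τ/ν)`
    have hG'ge : Cₒ * G₀ ^ 2 / (θ * B₀) ≤ G' := by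
      rw [hG', hBabs]; linarith [le_max_right G₀ (Cₒ * G₀ ^ 2 / (θ * B₀))]
    have hθB : 0 < θ * B₀ := mul_pos hθ hB₀
    have h2 : Cₒ * G₀ ^ 2 ≤ θ * B₀ * G' := by
      have := mul_le_mul_of_nonneg_left hG'ge hθB.le
      rwa [mul_div_cancel₀ _ hθB.ne'] at this
    have hsqrt_pos : 0 < Real.sqrt (τ / ν) := Real.sqrt_pos.2 (div_pos hτ.1 hν)
    have h3 : θ * B₀ < θ * B₀ * G' * Real.sqrt (τ / ν) := by
      calc θ * B₀ < Cₒ * G₀ ^ 2 * Real.sqrt (τ / ν) := hgap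
        _ ≤ θ * B₀ * G' * Real.sqrt (τ / ν) := mul_le_mul_of_nonneg_right h2 hsqrt_pos.le
    have h4 : 1 < G' * Real.sqrt (τ / ν) := by
      refine lt_of_mul_lt_mul_left (a := θ * B₀) ?_ hθB.le
      rw [mul_one]
      calc θ * B₀ < θ * B₀ * G' * Real.sqrt (τ / ν) := h3
        _ = θ * B₀ * (G' * Real.sqrt (τ / ν)) := by ring
    have h5 : 1 < G' ^ 2 * (τ / ν) := by
      have hsq := mul_self_lt_mul_self zero_le_one h4
      rw [one_mul] at hsq
      calc (1 : ℝ) < G' * Real.sqrt (τ / ν) * (G' * Real.sqrt (τ / ν)) := hsq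
        _ = G' ^ 2 * (Real.sqrt (τ / ν) * Real.sqrt (τ / ν)) := by ring
        _ = G' ^ 2 * (τ / ν) := by rw [Real.mul_self_sqrt (div_pos hτ.1 hν).le]
    have hG'2 : 0 < G' ^ 2 := by positivity
    rw [div_lt_iff₀ hG'2]
    have h6 : ν < G' ^ 2 * τ := by
      have h7 := mul_lt_mul_of_pos_right h5 hν
      rw [one_mul] at h7
      calc ν < G' ^ 2 * (τ / ν) * ν := h7
        _ = G' ^ 2 * τ := by field_simp
    linarith [mul_comm (G' ^ 2) τ]
  exact hP hν hT hG'pos hcl hLH hE₀' hbdG' τ ⟨hdelay, hτ'.2⟩ x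

/-! ### The early bookkeeping with margin, unconditionally -/

/-- **Early bookkeeping with margin (unconditional).** There is an absolute `cₑ > 0` such that for
all `ν, T > 0` and every `θ > 0` there is `F` such that every classical Leray–Hopf solution on
`ℝ³ × [0,T)` from a rapidly decaying datum with `∫|u₀|² ≤ E₀`, `|u₀| ≤ B₀` satisfies, for
`M ≥ 2(1+θ)B₀`, `c ∈ [M/2,M]`, `c > 0`, `t ∈ [0,T)`, `t ≤ cₑν/B₀²`:
`PW_c(t) ≤ √(F(E₀,B₀) V_c(T)) √(D_c(T))`. (`cₑ = c₀/2` with `c₀` of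
`levelSetModeration_earlyWindow`; on `[0, min(T, c₀ν/B₀²))` the solution is bounded by `2B₀`, and
`levelSetModeration_exists_marginModulus` applies on that horizon.) The registered
`stub_earlyBookkeeping` is the case `θ = 0`. [folklore] -/
theorem levelSetModeration_earlyBookkeepingWithMargin :
    ∃ cₑ : ℝ, 0 < cₑ ∧ ∀ (ν T : ℝ), 0 < ν → 0 < T → ∀ θ : ℝ, 0 < θ → ∃ F : ℝ → ℝ → ℝ, ∀ (u : ℝ → EuclideanSpace ℝ (Fin 3) → EuclideanSpace ℝ (Fin 3)) (p : ℝ → EuclideanSpace ℝ (Fin 3) → ℝ), Literature.Analysis.FluidPDE.IsClassicalNSSolutionOn (Set.Ico 0 T) ν 0 u p → Literature.Analysis.FluidPDE.IsLerayHopfOn T ν 0 (u 0) u → Literature.Analysis.FluidPDE.HasRapidSpatialDecay (u 0) → ∀ (E₀ B₀ : ℝ), (∫ x, ‖u 0 x‖ ^ 2) ≤ E₀ → (∀ x, ‖u 0 x‖ ≤ B₀) → ∀ (M c t : ℝ), 2 * (1 + θ) * B₀ ≤ M → M / 2 ≤ c → c ≤ M → 0 < c → t ∈ Set.Ico 0 T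 → t ≤ cₑ * ν / B₀ ^ 2 → -(∫ τ in Set.Ioo 0 t, ∫ x, max (1 - c / ‖u τ x‖) 0 * (fderiv ℝ (Literature.Analysis.FluidPDE.normalisedPressure (u τ)) x (u τ x))) ≤ Real.sqrt (F E₀ B₀ * (∫⁻ τ in Set.Ioo 0 T, MeasureTheory.volume {x | c < ‖u τ x‖}).toReal) * Real.sqrt (∫⁻ τ in Set.Ioo 0 T, ∫⁻ x, Set.indicator {x | c < ‖u τ x‖} (fun x => ENNReal.ofReal (‖fderiv ℝ (fun y => ‖u τ y‖) x‖ ^ 2)) x).toReal := by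
  obtain ⟨c₀, hc₀, hW⟩ := levelSetModeration_earlyWindow
  refine ⟨c₀ / 2, by positivity, ?_⟩
  intro ν T hν hT θ hθ
  obtain ⟨Kf, hKf0, hK⟩ := levelSetModeration_exists_marginModulus hν
  refine ⟨fun E₀ B₀ => (Kf θ (2 * |B₀| + 1) E₀ B₀) ^ 2, ?_⟩
  intro u p hcl hLH hdec E₀ B₀ hE₀ hbd0 M c t hM hMc hcM hc ht hte
  beta_reduce
  rcases le_or_gt B₀ 0 with hB | hB₀
  · -- zero datum: `u ≡ 0`, bounded by `2|B₀| + 1` on the full horizon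
    have h0 : ∀ y, u 0 y = 0 := fun y => norm_le_zero_iff.1 ((hbd0 y).trans hB)
    have hbg : ∀ s ∈ Ico 0 T, ∀ x, ‖u s x‖ ≤ 2 * |B₀| + 1 := fun s hs x => by
      rw [levelSetModeration_slice_eq_zero_of_datum hcl hLH hν.le h0 hs x, norm_zero]; positivity
    exact hK hT hcl hLH hdec hE₀ hbd0 hbg hθ M c t hM hMc hcM hc ht
  -- positive datum bound: work on the horizon `Tₑ = min T (c₀ ν / B₀²)`
  set Tₑ : ℝ := min T (c₀ * ν / B₀ ^ 2) with hTₑ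
  have hTₑpos : 0 < Tₑ := lt_min hT (by positivity)
  have hTₑT : Tₑ ≤ T := min_le_left _ _
  have htTₑ : t < Tₑ := by
    refine lt_min ht.2 (lt_of_le_of_lt hte ?_)
    have : c₀ / 2 * ν / B₀ ^ 2 < c₀ * ν / B₀ ^ 2 :=
      div_lt_div_of_pos_right (by nlinarith) (by positivity)
    exact this
  have hcl' : IsClassicalNSSolutionOn (Ico 0 Tₑ) ν 0 u p :=
    hcl.mono (Ico_subset_Ico_right hTₑT) (uniqueDiffOn_Ico 0 Tₑ)
  have hLH' : IsLerayHopfOn Tₑ ν 0 (u 0) u := hLH.of_le hTₑT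
  have hbg : ∀ s ∈ Ico 0 Tₑ, ∀ x, ‖u s x‖ ≤ 2 * |B₀| + 1 := by
    intro s hs x
    have hsT : s ∈ Ico 0 T := ⟨hs.1, hs.2.trans_le hTₑT⟩
    have hsc : s < c₀ * ν / B₀ ^ 2 := hs.2.trans_le (min_le_right _ _)
    have h := (hW ν T u p hν hT hcl hLH hdec B₀ hB₀ hbd0 s hsT hsc).1 x
    rw [abs_of_pos hB₀]; linarith
  have key := hK hTₑpos hcl' hLH' hdec hE₀ hbd0 hbg hθ M c t hM hMc hcM hc ⟨ht.1, htTₑ⟩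
  -- monotonicity of `V` and `D` in the horizon
  have hsub : Ioo 0 Tₑ ⊆ Ioo 0 T := Ioo_subset_Ioo_right hTₑT
  have hVfin : (∫⁻ τ in Ioo 0 T, volume {x | c < ‖u τ x‖}) ≠ ⊤ :=
    ne_top_of_le_ne_top ENNReal.ofReal_ne_top (levelSetVolume_le hLH hν.le hT.le hc)
  have hDfin := (levelSetDissipation_ne_top hcl hLH hT hν.le hc.le).1
  have hV : (∫⁻ τ in Ioo 0 Tₑ, volume {x | c < ‖u τ x‖}).toReal ≤
      (∫⁻ τ in Ioo 0 T, volume {x | c < ‖u τ x‖}).toReal :=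
    ENNReal.toReal_mono hVfin (lintegral_mono_set hsub)
  have hD : (∫⁻ τ in Ioo 0 Tₑ, ∫⁻ x, {x | c < ‖u τ x‖}.indicator
      (fun x => ENNReal.ofReal (‖fderiv ℝ (fun y => ‖u τ y‖) x‖ ^ 2)) x).toReal ≤
      (∫⁻ τ in Ioo 0 T, ∫⁻ x, {x | c < ‖u τ x‖}.indicator
      (fun x => ENNReal.ofReal (‖fderiv ℝ (fun y => ‖u τ y‖) x‖ ^ 2)) x).toReal :=
    ENNReal.toReal_mono hDfin (lintegral_mono_set hsub)
  refine key.trans ?_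
  gcongr

end Summit.NavierStokesRegularity.NavierStokesRegularity.Theorems

end
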